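import Summits.BirchSwinnertonDyer.BirchSwinnertonDyer.Theorems.AlignedTransportAtTwoMainConjectureOfRankZeroBSDAtTwoCyclotomicLayerRoad
import Summits.BirchSwinnertonDyer.BirchSwinnertonDyer.Theorems.AlignedTransportAtTwoMainConjectureOfRankZeroBSDAtTwoCyclotomicLayerRankDichotomy
import HarnessLib

/-!
# Route `AlignedTransportAtTwo`, crux C2 `MainConjectureOfRankZeroBSDAtTwo` (stmt-BirchSwinnertonDyer-22298):
# ON THE `a₂ = +1` ROAD THE MORDELL–WEIL RANK IS STATIONARY ABOVE `ℚ(√2)` EXCEPT FOR AT MOST ONE JUMP, at the layer `n+1` with `2ⁿ = λ₂ − 1`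

HONEST FRAMING (cell `bsd-f1-sign2`, WIDTH-5 attached prover seat `bsd-line-att-p5` gen 36 on line `birth` of the lead `bsd-line-att-p2`;
`--supports` stmt-BirchSwinnertonDyer-22298, closes nothing; BSD is NOT proved by any of this; the crux C2, its verdict «blocked-on
`Rank1Residual.GreenbergMuConjectureIrreducible`» and every registered stub are untouched). THEOREMS ONLY — no `def`, no named fact, no `sorry`; print binders
exactly the lineage's (`h17` = Kato 17.4 (1)(2) at `2`; `hGZK` only where `rank W(ℚ) = 0` is read from `r_an = 0`). Assembly of this gen's layer dichotomy
(`…CyclotomicLayerRankDichotomy`: `rank W(ℚ_{n+1}) = rank W(ℚ_n)` OR `Φ_{2^{n+1}}(1+T) ∣ f_X`) with the road rigidity (`…CyclotomicLayerRoad`: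
`Φ_{2^{n+1}}(1+T) ∣ f_X`, `n ≥ 1 ⇒ λ₂ = 2ⁿ + 1`):

* ★★ `mordellWeilRank_layer_succ_eq_of_road_of_lam_ne` — **`n ≥ 1`, `λ₂ ≠ 2ⁿ + 1 ⇒ rank W(ℚ_{n+1}) = rank W(ℚ_n)`**; `…_of_ne` (at most ONE jump above `ℚ₁`,
  at `2^{n₀} = λ₂ − 1`);
* ★★ `mordellWeilRank_layer_eq_layer_one_of_road` — **if `λ₂ − 1` is not a power of two (`λ₂ ∈ {7, 11, 13, 15, …}`; census: 3547, 139, 5579, 2515) then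
  `rank W(ℚ_m) = rank W(ℚ₁)` for every `m ≥ 1`**; `mordellWeilRank_layer_le_one_of_road` (`+ hGZK`, g34: **`≤ 1` at every layer**): THE MORDELL–WEIL RANK IS
  STATIONARY ABOVE `ℚ(√2)` ALONG THE WHOLE CYCLOTOMIC `ℤ₂`-TOWER. With the parity prediction `rank W(ℚ(√2))` odd (`w(W ⊗ χ₈) = −1`) this reads
  «`rank W(ℚ_∞) = 1`, all of it over `ℚ(√2)`»; the g34 door «rank `≥ 2` somewhere up the tower ⟹ MC₂» can fire only for `λ₂ ∈ {3, 5, 9, 17, …}`, at layer `n₀ + 1`.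

References: R. Greenberg, LNM 1716 (1999), Thm. 1.9, §5 pp. 132, 176–177 [GreenbergLNM1716]; K. Kato, Astérisque 295 (2004), Thm. 17.4 [Kato2004Asterisque].
-/

set_option linter.dupNamespace false
set_option autoImplicit false

noncomputable section

open scoped Classical MatrixGroups ModularForm Polynomial

namespace Summit.BirchSwinnertonDyer.BirchSwinnertonDyer.Theorems.AlignedTransportAtTwoCyclotomicLayerRoadStationary

open WeierstrassCurve Literature.NumberTheory.EllipticCurves
  Literature.NumberTheory.EllipticCurves.ModularForms
  Literature.NumberTheory.EllipticCurves.Rank1Residual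
  Literature.NumberTheory.EllipticCurves.Rank1Residual.Typed
  Literature.NumberTheory.EllipticCurves.Greenberg1999
  Summit.BirchSwinnertonDyer.Rank1Residual
  Summit.BirchSwinnertonDyer.Rank1Residual.X1.MuLambda
  Summit.BirchSwinnertonDyer.Rank1Residual.X5
  Summit.BirchSwinnertonDyer.Rank1Residual.F1Sign2
  Summit.BirchSwinnertonDyer.Rank1Residual.Iwasawa
  Summit.BirchSwinnertonDyer.BirchSwinnertonDyer.Theorems.Rank1ResidualX1Defs
  Summit.BirchSwinnertonDyer.BirchSwinnertonDyer.Theorems.AlignedTransportAtTwoSeed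
  Summit.BirchSwinnertonDyer.BirchSwinnertonDyer.Theorems.AlignedTransportAtTwoCyclotomicLayerRankGrowth
  Summit.BirchSwinnertonDyer.BirchSwinnertonDyer.Theorems.AlignedTransportAtTwoCyclotomicLayerRoad
  Summit.BirchSwinnertonDyer.BirchSwinnertonDyer.Theorems.AlignedTransportAtTwoCyclotomicLayerRankDichotomy
  Summit.BirchSwinnertonDyer.BirchSwinnertonDyer.Theorems.AlignedTransportAtTwoLayerOneRankBound

section Road

open PowerSeries CongruenceSubgroup
  Summit.BirchSwinnertonDyer.BirchSwinnertonDyer.Theorems.AlignedTransportAtTwoEisensteinRigidityRoad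

variable (W : WeierstrassCurve ℚ) [W.IsElliptic] [W.IsGloballyMinimal]

/-- ★★ **`λ₂ ≠ 2ⁿ + 1` (`n ≥ 1`) ⇒ `rank W(ℚ_{n+1}) = rank W(ℚ_n)`** on the `a₂ = +1` road (`W/ℚ` globally minimal, good ordinary at `2`, `a₂ = +1`, `∏ c_v` odd,
`Δ_min ≡ 3,5 (8)`, `r_an = 0`, `‖[0]⁺_f‖₂ = 1`, `G` an integral lift of `L₂(f,α)` with `μ(G) = 0`; PRINT `h17`; `κ, γ` the normalised cyclotomic datum): by the
layer dichotomy, growth at layer `n+1` would put `Φ_{2^{n+1}}(1+T)` into `f_X`, forcing `λ₂ = 2ⁿ + 1` (companion `lam_eq_two_pow_add_one_of_road_of_cyclotomicLayer_dvd`).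
[cite: Kato2004Asterisque, Thm. 17.4 (1)(2) (p. 273)] [cite: GreenbergLNM1716, §5 p. 132 and p. 177] -/
theorem mordellWeilRank_layer_succ_eq_of_road_of_lam_ne [NeZero (W.conductorNorm ℤ)] {f : CuspForm (Gamma0 (W.conductorNorm ℤ)) 2}
    (h17 : kato_divisibility_allPrimes W 2 (f := f)) (hord : IsOrdinaryAt W 2) (hf : IsNewformOf W f)
    (ha : W.frobeniusTrace 2 = 1) (hodd : Odd W.tamagawaProduct)
    (hΔ : minimalDiscriminantInt W % 8 = 3 ∨ minimalDiscriminantInt W % 8 = 5) (hr : W.analyticRank = 0)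
    {G : IwasawaAlgebra 2} (hG : iwasawaToPowerSeries 2 G = padicLFunction f (unitRoot W 2 : ℚ_[2]))
    (hμ : mu G = 0) (hsym : ‖(ratPlusSymbol f 0 : ℚ_[2])‖ = 1)
    {κ : ZpExtension ℚ 2} {γ : Field.absoluteGaloisGroup ℚ} (hκ : κ.IsCyclotomic) (hγ : κ.IsTopGenerator γ)
    (hγ' : IsCyclotomicVariable 2 γ) {n : ℕ} (hn : 1 ≤ n) (hl : lam G ≠ 2 ^ n + 1) :
    (W.baseChange (κ.layer (n + 1))).mordellWeilRank = (W.baseChange (κ.layer n)).mordellWeilRank := by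
  obtain ⟨D⟩ := W.nonempty_selmerDualData_holds κ γ hγ
  haveI : Module.Finite (IwasawaAlgebra 2) D.X := D.module_finite_holds hγ
  haveI : (Module.charIdeal (IwasawaAlgebra 2) D.X).IsPrincipal := charIdeal_isPrincipal_holds 2 D.X
  obtain ⟨fX, hfX⟩ := Submodule.IsPrincipal.principal (Module.charIdeal (IwasawaAlgebra 2) D.X)
  have hchar : D.charIdeal = Ideal.span {fX} := hfX
  have hD : D.IsTorsion := (charGen_shape_of_road W h17 hord hf ha hodd hΔ hr hG hμ hsym hκ hγ hγ' D hchar).1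
  rcases mordellWeilRank_layer_succ_eq_or_cyclotomicLayer_dvd_charGen W hγ D hD hchar n with h | hdvd
  · exact h
  · exact absurd (AlignedTransportAtTwoCyclotomicLayerRoad.lam_eq_two_pow_add_one_of_road_of_cyclotomicLayer_dvd W h17 hord hf ha
      hodd hΔ hr hG hμ hsym hκ hγ hγ' D hchar hn hdvd) hl

/-- **At most ONE jump above `ℚ₁`**: on the `a₂ = +1` road, for every `n ≥ 1` with `2ⁿ ≠ λ₂ − 1`, `rank W(ℚ_{n+1}) = rank W(ℚ_n)` — the Mordell–Weil rank can
grow above `ℚ(√2)` only in the single layer `ℚ_{n₀+1}/ℚ_{n₀}` with `2^{n₀} = λ₂ − 1` (if `λ₂ − 1` is a power of two at all).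
[cite: Kato2004Asterisque, Thm. 17.4 (1)(2) (p. 273)] [cite: GreenbergLNM1716, §5 p. 177] -/
theorem mordellWeilRank_layer_succ_eq_of_road_of_ne [NeZero (W.conductorNorm ℤ)] {f : CuspForm (Gamma0 (W.conductorNorm ℤ)) 2}
    (h17 : kato_divisibility_allPrimes W 2 (f := f)) (hord : IsOrdinaryAt W 2) (hf : IsNewformOf W f)
    (ha : W.frobeniusTrace 2 = 1) (hodd : Odd W.tamagawaProduct)
    (hΔ : minimalDiscriminantInt W % 8 = 3 ∨ minimalDiscriminantInt W % 8 = 5) (hr : W.analyticRank = 0)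
    {G : IwasawaAlgebra 2} (hG : iwasawaToPowerSeries 2 G = padicLFunction f (unitRoot W 2 : ℚ_[2]))
    (hμ : mu G = 0) (hsym : ‖(ratPlusSymbol f 0 : ℚ_[2])‖ = 1)
    {κ : ZpExtension ℚ 2} {γ : Field.absoluteGaloisGroup ℚ} (hκ : κ.IsCyclotomic) (hγ : κ.IsTopGenerator γ)
    (hγ' : IsCyclotomicVariable 2 γ) {n : ℕ} (hn : 1 ≤ n) (hne : 2 ^ n ≠ lam G - 1) :
    (W.baseChange (κ.layer (n + 1))).mordellWeilRank = (W.baseChange (κ.layer n)).mordellWeilRank :=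
  mordellWeilRank_layer_succ_eq_of_road_of_lam_ne W h17 hord hf ha hodd hΔ hr hG hμ hsym hκ hγ hγ' hn
    (fun h ↦ hne (by rw [h, Nat.add_sub_cancel]))

/-- ★★ **IF `λ₂ − 1` IS NOT A POWER OF TWO, THE MORDELL–WEIL RANK IS STATIONARY ABOVE `ℚ(√2)` ALONG THE WHOLE CYCLOTOMIC `ℤ₂`-TOWER**: on the `a₂ = +1`
road with `λ₂ ≠ 2ⁿ + 1` for every `n ≥ 1` (e.g. `λ₂ ∈ {7, 11, 13, 15}`: conductors 3547, 139, 5579, 2515 of the cell's census), `rank W(ℚ_m) = rank W(ℚ₁)` for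
every `m ≥ 1`. [cite: Kato2004Asterisque, Thm. 17.4 (1)(2) (p. 273)] [cite: GreenbergLNM1716, §5 p. 132] -/
theorem mordellWeilRank_layer_eq_layer_one_of_road [NeZero (W.conductorNorm ℤ)] {f : CuspForm (Gamma0 (W.conductorNorm ℤ)) 2}
    (h17 : kato_divisibility_allPrimes W 2 (f := f)) (hord : IsOrdinaryAt W 2) (hf : IsNewformOf W f)
    (ha : W.frobeniusTrace 2 = 1) (hodd : Odd W.tamagawaProduct)
    (hΔ : minimalDiscriminantInt W % 8 = 3 ∨ minimalDiscriminantInt W % 8 = 5) (hr : W.analyticRank = 0)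
    {G : IwasawaAlgebra 2} (hG : iwasawaToPowerSeries 2 G = padicLFunction f (unitRoot W 2 : ℚ_[2]))
    (hμ : mu G = 0) (hsym : ‖(ratPlusSymbol f 0 : ℚ_[2])‖ = 1)
    {κ : ZpExtension ℚ 2} {γ : Field.absoluteGaloisGroup ℚ} (hκ : κ.IsCyclotomic) (hγ : κ.IsTopGenerator γ)
    (hγ' : IsCyclotomicVariable 2 γ) (hl : ∀ n : ℕ, 1 ≤ n → lam G ≠ 2 ^ n + 1) {m : ℕ} (hm : 1 ≤ m) :
    (W.baseChange (κ.layer m)).mordellWeilRank = (W.baseChange (κ.layer 1)).mordellWeilRank := by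
  induction m, hm using Nat.le_induction with
  | base => rfl
  | succ m hm ih => rw [mordellWeilRank_layer_succ_eq_of_road_of_lam_ne W h17 hord hf ha hodd hΔ hr hG hμ hsym hκ hγ hγ' hm (hl m hm), ih]

/-- **… and then `rank W(ℚ_m) ≤ 1` at EVERY layer** (`+ hGZK`: the g34 bound `rank W(ℚ₁) ≤ 1` at the second fixed point). With the parity prediction
`rank W(ℚ(√2))` odd (`w(W ⊗ χ₈) = −1` on the road) this is «`rank W(ℚ_∞) = 1`, all of it over `ℚ(√2)`» for every road curve whose `λ₂ − 1` is not a power of two.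
[cite: Kato2004Asterisque, Thm. 17.4 (1)(2) (p. 273)] [cite: GreenbergLNM1716, §5 p. 176] -/
theorem mordellWeilRank_layer_le_one_of_road [NeZero (W.conductorNorm ℤ)] {f : CuspForm (Gamma0 (W.conductorNorm ℤ)) 2}
    (h17 : kato_divisibility_allPrimes W 2 (f := f)) (hGZK : rank_eq_analyticRank_of_analyticRank_le_one)
    (hord : IsOrdinaryAt W 2) (hf : IsNewformOf W f) (ha : W.frobeniusTrace 2 = 1) (hodd : Odd W.tamagawaProduct)
    (hΔ : minimalDiscriminantInt W % 8 = 3 ∨ minimalDiscriminantInt W % 8 = 5) (hr : W.analyticRank = 0)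
    {G : IwasawaAlgebra 2} (hG : iwasawaToPowerSeries 2 G = padicLFunction f (unitRoot W 2 : ℚ_[2]))
    (hμ : mu G = 0) (hsym : ‖(ratPlusSymbol f 0 : ℚ_[2])‖ = 1)
    {κ : ZpExtension ℚ 2} {γ : Field.absoluteGaloisGroup ℚ} (hκ : κ.IsCyclotomic) (hγ : κ.IsTopGenerator γ)
    (hγ' : IsCyclotomicVariable 2 γ) (hl : ∀ n : ℕ, 1 ≤ n → lam G ≠ 2 ^ n + 1) (m : ℕ) :
    (W.baseChange (κ.layer m)).mordellWeilRank ≤ 1 := by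
  have h1 : (W.baseChange (κ.layer 1)).mordellWeilRank ≤ 1 :=
    AlignedTransportAtTwoLayerOneRankBound.mordellWeilRank_layer_one_le_one_of_road W h17 hGZK hord hf ha hodd hΔ hr hG hsym hκ hγ hγ'
  rcases Nat.eq_zero_or_pos m with rfl | hm
  · exact (mordellWeilRank_layer_mono W κ (Nat.zero_le 1)).trans h1
  · rw [mordellWeilRank_layer_eq_layer_one_of_road W h17 hord hf ha hodd hΔ hr hG hμ hsym hκ hγ hγ' hl hm]; exact h1

end Road

end Summit.BirchSwinnertonDyer.BirchSwinnertonDyer.Theorems.AlignedTransportAtTwoCyclotomicLayerRoadStationary
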